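import Literature.MathematicalPhysics.QuantumFieldTheory.Balaban1983to89.B7Prop3GeneralRotated
import Literature.MathematicalPhysics.QuantumFieldTheory.Balaban1983to89.T4TermwiseBCH
import Summits.QuantumFields.YangMills.Theorems.UnitScaleTiltProp7AvgTrueLinearisation
import HarnessLib

/-!
# Route `UnitScaleTilt`, crux K1 «MinimiserStabilityRegPr» (stmt-QuantumFields-19200), route-R E′ (A′)-on-Σ, P-A2 (β), row «(n3)-comb» —
# (O2) GROUNDWORK, file F-2a: THE RELATIVE HOLONOMY OF `V₁V₀` AGAINST `V₀` ALONG AN ARBITRARY WORD OF `ℤᵈ`, TO FIRST ORDER, WITH A PER-STEP REMAINDER: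
# `‖(V₁V₀)(Γ)·V₀(Γ)⁻¹ − 1 − (R_{0,x}Y)(Γ)‖ ≤ Π_{s∈Γ}(1 + ‖Y_{b(s)}‖) − 1 − Σ_s‖Y_{b(s)}‖ + Σ_s‖Y_{b(s)}‖² ≤ 2·(Σ_s‖Y_{b(s)}‖)²`

«(O2) groundwork — not consumed by any displayed row before the freeze lifts» (★★OWNER `ym3-torus-plan` g29 RULING №20 (2), 2026-08-29).
Cell `ym3-torus`, D-0154 (3c) R3 twin-width seat `ym-routeR-w1` (gen 9); LOCATE of record II `LOCATE-N3COMB-TRANSFER-routeRw1g9.md` (19200 evidence #58) §6, file F-2 part a.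
THEOREMS ONLY (0 `def`, 0 `sorry`); `--supports stmt-QuantumFields-19200 --as helper`, count-neutral.  YM₃ on T³ is a ladder rung (R3), not the Clay problem;
nothing here claims `hMcomb`, `hMcomb₂`, (β), `hPA2`, `hcoS`, the stub, the crux, d = 4 or the mass gap.

THE POINT.  ★p1 g4's ✓`Prop7HolRatioPerStep.norm_holRatio_bounds_perStep` is the per-step (no uniform `δ`) form of the relative holonomy bound on the T³ tower
(lit `LatticeWordStokes.walk`, `holAt`, `covWalkSum`, `SU(N)` adjoints).  The (n3)-comb twin works on PRINT's objects, which live on `ℤᵈ` in lit's letters: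
`B7Prop1Explicit.hol`∕`stepHol` ((9) p.18), the covariant walk sum `B7Prop3GeneralRotated.tsum` = print's `(R_{0,y}A)(Γ)` ((58) p.27, "the product over b
replaced by the sum"), units of a complete normed algebra in the class `U1 = {‖u‖ ≤ 1, ‖u⁻¹‖ ≤ 1}` (inverses instead of adjoints).  Same recursion
`D(s·Γ) = Z_s + g_sD(Γ)g_s⁻¹ + Z_s·g_sD(Γ)g_s⁻¹` with `‖Z_s‖ ≤ δ_s`, `‖Z_s − (covariant step)‖ ≤ δ_s²`, `δ_s = ‖Y_{b(s)}‖` (`Y = V₁ − 1`); the steps of a word are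
listed def-free as the `(site, letter)` pairs `List.zip (List.scanl (· + vec ·) x Γ) Γ`, the step mass being `‖stepA Y site letter‖` (lit (61)'s letter term).
The pure-real letters (`Π(1+a) ≤ e^{Σa}`, `Σa² ≤ (Σa)²`, `Π(1+a) − 1 ≤ 2Σa`) are ★p1's, imported by name.

WHAT IS PROVED (ns `…Theorems.Prop7CombHolRatioPerStep`; `𝔸` any normed ring with `‖1‖ = 1`; every `d`).
* §1 `U1` letters: `norm_coe_le_one_of_mem_U1`, `norm_coe_inv_le_one_of_mem_U1`, `norm_coe_inv_sub_one_add_le` (`‖u⁻¹ − 1 + (u − 1)‖ ≤ ‖u − 1‖²`);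
  `‖u⁻¹ − 1‖ ≤ ‖u − 1‖` and `‖uXu⁻¹‖ ≤ ‖X‖` are lit ✓`B7Prop1Explicit.norm_inv_sub_one_le`, ✓`T4TermwiseBCH.norm_units_conj_le` (imported, not restated).
* §2 `zip_scanl_cons`∕`zip_scanl_nil`; ★ `norm_holRatio_bounds_perStep` (the title, both bounds, every word); ★ `norm_holRatio_le_of_mass_le`
  (`‖D(Γ)‖ ≤ 2m`, `‖D(Γ) − (R_{0,x}Y)(Γ)‖ ≤ 2m²` once the walk mass `≤ m ≤ 1`).
HONEST SCOPE.  Algebra and the triangle inequality along a word; no averaging here (that is part b, `…Prop7CombTildTrueLin`).  Nothing of Bałaban's is asserted.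

References: T. Bałaban, CMP **98** (1985) 17–51 [Balaban1985Averaging] ((9) p.18, (19) p.21, (56)–(58) p.27, (61) p.28, (122)–(123) p.36);
CMP **102** (1985) 277–309 [Balaban1985Variational] ((15) p.280, (44) p.285).
-/

noncomputable section

open scoped BigOperators

namespace Summit.QuantumFields.YangMills.Theorems.Prop7CombHolRatioPerStep

open Literature.MathematicalPhysics.QuantumFieldTheory.Balaban1983to89
open B7Prop1Explicit (Site Letter hol stepHol U1 mem_U1 stepA hol_cons norm_inv_sub_one_le)
open T4TermwiseBCH (norm_units_conj_le)
open B7Prop2Explicit (stepHol_mem_of)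
open B7Eq78Linearization (conjR conjR_apply)
open B7Prop3GeneralRotated (tsum tstep tsum_cons norm_conjR_le)
open Summit.QuantumFields.YangMills.Theorems.Prop7HolRatioPerStep
  (list_prod_one_add_le_exp_sum list_sum_sq_le_sq_sum list_prod_one_add_sub_one_le_two_mul)

section Letters

variable {𝔸 : Type*} [NormedRing 𝔸] [NormOneClass 𝔸]

/-! ## §1 `U1` letters -/

/-- `‖u‖ ≤ 1` for `u ∈ U1`. [cite: Balaban1985Averaging, (19) p.21] -/
theorem norm_coe_le_one_of_mem_U1 {u : 𝔸ˣ} (hu : u ∈ U1 𝔸) : ‖(u : 𝔸)‖ ≤ 1 := (mem_U1.1 hu).1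

/-- `‖u⁻¹‖ ≤ 1` for `u ∈ U1`. [cite: Balaban1985Averaging, (19) p.21] -/
theorem norm_coe_inv_le_one_of_mem_U1 {u : 𝔸ˣ} (hu : u ∈ U1 𝔸) : ‖((u⁻¹ : 𝔸ˣ) : 𝔸)‖ ≤ 1 := (mem_U1.1 hu).2

/-- `‖u⁻¹ − 1 + (u − 1)‖ ≤ ‖u − 1‖²` for `u ∈ U1` (`u⁻¹ − 1 + (u − 1) = u⁻¹(u − 1)²`). [folklore] -/
theorem norm_coe_inv_sub_one_add_le {u : 𝔸ˣ} (hu : u ∈ U1 𝔸) :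
    ‖((u⁻¹ : 𝔸ˣ) : 𝔸) - 1 + ((u : 𝔸) - 1)‖ ≤ ‖(u : 𝔸) - 1‖ ^ 2 := by
  have e : ((u⁻¹ : 𝔸ˣ) : 𝔸) - 1 + ((u : 𝔸) - 1) = ((u⁻¹ : 𝔸ˣ) : 𝔸) * (((u : 𝔸) - 1) * ((u : 𝔸) - 1)) := by
    have h1 : ((u⁻¹ : 𝔸ˣ) : 𝔸) * (u : 𝔸) = 1 := Units.inv_mul u
    have e1 : ((u⁻¹ : 𝔸ˣ) : 𝔸) * (((u : 𝔸) - 1) * ((u : 𝔸) - 1))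
        = ((u⁻¹ : 𝔸ˣ) : 𝔸) * (u : 𝔸) * (u : 𝔸) - ((u⁻¹ : 𝔸ˣ) : 𝔸) * (u : 𝔸) - ((u⁻¹ : 𝔸ˣ) : 𝔸) * (u : 𝔸) + ((u⁻¹ : 𝔸ˣ) : 𝔸) := by
      noncomm_ring
    rw [e1, h1]; noncomm_ring
  rw [e]
  calc _ ≤ ‖((u⁻¹ : 𝔸ˣ) : 𝔸)‖ * ‖((u : 𝔸) - 1) * ((u : 𝔸) - 1)‖ := norm_mul_le _ _
    _ ≤ 1 * (‖(u : 𝔸) - 1‖ * ‖(u : 𝔸) - 1‖) :=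
        mul_le_mul (norm_coe_inv_le_one_of_mem_U1 hu) (norm_mul_le _ _) (norm_nonneg _) zero_le_one
    _ = ‖(u : 𝔸) - 1‖ ^ 2 := by ring

end Letters

section PerStep

variable {d : ℕ} {𝔸 : Type*} [NormedRing 𝔸] [NormOneClass 𝔸]

/-! ## §2 ★ The relative holonomy along an arbitrary word of `ℤᵈ`, per-step bounds -/

/-- The steps of a word, as (start site, letter) pairs, unfold: the steps of `l :: w` from `x` are `(x, l)` then the steps of `w` from `x + vec l`
(the `ℤᵈ` reading of lit `LatticeWordStokes.walk`). [folklore] -/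
theorem zip_scanl_cons (x : Site d) (l : Letter d) (w : List (Letter d)) :
    List.zip (List.scanl (fun (y : Site d) (l' : Letter d) => y + l'.vec) x (l :: w)) (l :: w)
      = (x, l) :: List.zip (List.scanl (fun (y : Site d) (l' : Letter d) => y + l'.vec) (x + l.vec) w) w := by
  rw [List.scanl_cons, List.zip_cons_cons]

/-- The empty word has no steps. [folklore] -/
theorem zip_scanl_nil (x : Site d) :
    List.zip (List.scanl (fun (y : Site d) (l' : Letter d) => y + l'.vec) x ([] : List (Letter d))) ([] : List (Letter d)) = [] := by
  simp

/-- ★ **THE RELATIVE HOLONOMY TO FIRST ORDER, PER-STEP REMAINDER, ON `ℤᵈ`**: `V₀` and `V₁` take values in `U1 = {‖u‖ ≤ 1, ‖u⁻¹‖ ≤ 1}`,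
`Y_b = V₁(b) − 1`; for every word `Γ` from `x`, with `D(Γ) = (V₁V₀)(Γ)·V₀(Γ)⁻¹ − 1`, `(R_{0,x}Y)(Γ)` the covariant walk sum (lit `tsum`) and
`δ_s = ‖Y_{b(s)}‖ = ‖stepA Y s₁ s₂‖` the step masses over the steps `s = (site, letter)` of the word: `‖D(Γ)‖ ≤ Π_s(1 + δ_s) − 1` and
`‖D(Γ) − (R_{0,x}Y)(Γ)‖ ≤ Π_s(1 + δ_s) − 1 − Σ_sδ_s + Σ_sδ_s²` — the `ℤᵈ`∕`U1` twin of ✓`Prop7HolRatioPerStep.norm_holRatio_bounds_perStep`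
(recursion `D(s·Γ) = Z_s + g_sD(Γ)g_s⁻¹ + Z_s·g_sD(Γ)g_s⁻¹`, `‖Z_s‖ ≤ δ_s`, `‖Z_s − (covariant step)‖ ≤ δ_s²`). [cite: Balaban1985Averaging, (9) p.18, (58) p.27, (122)-(123) p.36] -/
theorem norm_holRatio_bounds_perStep (V₀ V₁ : Site d → Fin d → 𝔸ˣ) (hV₀ : ∀ x μ, V₀ x μ ∈ U1 𝔸) (hV₁ : ∀ x μ, V₁ x μ ∈ U1 𝔸)
    (Y : Site d → Fin d → 𝔸) (hY : ∀ x μ, Y x μ = ((V₁ x μ : 𝔸ˣ) : 𝔸) - 1) :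
    ∀ (x : Site d) (w : List (Letter d)),
      ‖((hol (V₁ * V₀) x w : 𝔸ˣ) : 𝔸) * (((hol V₀ x w)⁻¹ : 𝔸ˣ) : 𝔸) - 1‖
          ≤ ((List.zip (List.scanl (fun (y : Site d) (l' : Letter d) => y + l'.vec) x w) w).map
              fun s => 1 + ‖stepA Y s.1 s.2‖).prod - 1 ∧
      ‖((hol (V₁ * V₀) x w : 𝔸ˣ) : 𝔸) * (((hol V₀ x w)⁻¹ : 𝔸ˣ) : 𝔸) - 1 - tsum V₀ Y x w‖
          ≤ ((List.zip (List.scanl (fun (y : Site d) (l' : Letter d) => y + l'.vec) x w) w).map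
              fun s => 1 + ‖stepA Y s.1 s.2‖).prod - 1
            - ((List.zip (List.scanl (fun (y : Site d) (l' : Letter d) => y + l'.vec) x w) w).map fun s => ‖stepA Y s.1 s.2‖).sum
            + ((List.zip (List.scanl (fun (y : Site d) (l' : Letter d) => y + l'.vec) x w) w).map fun s => ‖stepA Y s.1 s.2‖ ^ 2).sum
  | x, [] => by simp
  | x, l :: w => by
    obtain ⟨ih₀, ih₁⟩ := norm_holRatio_bounds_perStep V₀ V₁ hV₀ hV₁ Y hY (x + l.vec) w
    rw [zip_scanl_cons, List.map_cons, List.prod_cons, List.map_cons, List.sum_cons, List.map_cons, List.sum_cons]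
    -- letters
    set F : 𝔸 := ((hol (V₁ * V₀) (x + l.vec) w : 𝔸ˣ) : 𝔸) with hF
    set F₀i : 𝔸 := (((hol V₀ (x + l.vec) w)⁻¹ : 𝔸ˣ) : 𝔸) with hF₀i
    set f : 𝔸ˣ := stepHol (V₁ * V₀) x l with hf
    set g : 𝔸ˣ := stepHol V₀ x l with hg
    set D : 𝔸 := F * F₀i - 1 with hD
    set Λ : 𝔸 := tsum V₀ Y (x + l.vec) w with hΛ
    set Pg : ℝ := ((List.zip (List.scanl (fun (y : Site d) (l' : Letter d) => y + l'.vec) (x + l.vec) w) w).map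
      fun s => 1 + ‖stepA Y s.1 s.2‖).prod with hPg
    set Sg : ℝ := ((List.zip (List.scanl (fun (y : Site d) (l' : Letter d) => y + l'.vec) (x + l.vec) w) w).map
      fun s => ‖stepA Y s.1 s.2‖).sum with hSg
    set Sg2 : ℝ := ((List.zip (List.scanl (fun (y : Site d) (l' : Letter d) => y + l'.vec) (x + l.vec) w) w).map
      fun s => ‖stepA Y s.1 s.2‖ ^ 2).sum with hSg2
    set δs : ℝ := ‖stepA Y x l‖ with hδs
    have hδs0 : 0 ≤ δs := norm_nonneg _
    have hg1 : g ∈ U1 𝔸 := stepHol_mem_of hV₀ x l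
    -- the exact relative step term `Z = f g⁻¹ − 1`
    set Z : 𝔸 := (f : 𝔸) * ((g⁻¹ : 𝔸ˣ) : 𝔸) - 1 with hZ
    have hZ0 : ‖Z‖ ≤ δs ∧ ‖Z - tstep V₀ Y x l‖ ≤ δs ^ 2 := by
      obtain ⟨μ, b⟩ := l
      cases b
      · -- backward letter `(μ, false)`: bond `b = (x − e_μ, μ)`, `f g⁻¹ = g·V₁(b)⁻¹·g⁻¹` with `g = V₀(b)⁻¹`
        have hfg : (f : 𝔸) * ((g⁻¹ : 𝔸ˣ) : 𝔸) = (g : 𝔸) * (((V₁ (x + Letter.vec (μ, false)) μ)⁻¹ : 𝔸ˣ) : 𝔸) * ((g⁻¹ : 𝔸ˣ) : 𝔸) := by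
          have hf' : f = (V₁ (x + Letter.vec (μ, false)) μ * V₀ (x + Letter.vec (μ, false)) μ)⁻¹ := by
            rw [hf]; unfold stepHol; simp [Pi.mul_apply]
          have hg' : g = (V₀ (x + Letter.vec (μ, false)) μ)⁻¹ := by rw [hg]; unfold stepHol; simp
          rw [hf', hg', mul_inv_rev, inv_inv, Units.val_mul]
        have htstep : tstep V₀ Y x (μ, false) = -((g : 𝔸) * Y (x + Letter.vec (μ, false)) μ * ((g⁻¹ : 𝔸ˣ) : 𝔸)) := by
          unfold tstep; simp only [Bool.false_eq_true, ↓reduceIte]; rw [conjR_apply]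
        have hV₁b := hV₁ (x + Letter.vec (μ, false)) μ
        have eZ : Z = (g : 𝔸) * ((((V₁ (x + Letter.vec (μ, false)) μ)⁻¹ : 𝔸ˣ) : 𝔸) - 1) * ((g⁻¹ : 𝔸ˣ) : 𝔸) := by
          rw [hZ, hfg, mul_sub, sub_mul, mul_one, Units.mul_inv]
        have hstepA : δs = ‖((V₁ (x + Letter.vec (μ, false)) μ : 𝔸ˣ) : 𝔸) - 1‖ := by
          rw [hδs]; unfold stepA; simp only [Bool.false_eq_true, ↓reduceIte, norm_neg]; rw [hY]
        constructor
        · rw [eZ]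
          exact (norm_units_conj_le hg1 _).trans (by rw [hstepA]; exact norm_inv_sub_one_le hV₁b)
        · have e2 : Z - tstep V₀ Y x (μ, false)
              = (g : 𝔸) * ((((V₁ (x + Letter.vec (μ, false)) μ)⁻¹ : 𝔸ˣ) : 𝔸) - 1 + Y (x + Letter.vec (μ, false)) μ) * ((g⁻¹ : 𝔸ˣ) : 𝔸) := by
            rw [eZ, htstep]; noncomm_ring
          rw [e2]
          refine (norm_units_conj_le hg1 _).trans ?_
          rw [hY, hstepA]
          exact norm_coe_inv_sub_one_add_le hV₁b
      · -- forward letter `(μ, true)`: `f g⁻¹ = V₁(x, μ)`, `Z = Y(x, μ)` exactly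
        have hfg : (f : 𝔸) * ((g⁻¹ : 𝔸ˣ) : 𝔸) = ((V₁ x μ : 𝔸ˣ) : 𝔸) := by
          have hf' : f = V₁ x μ * V₀ x μ := by rw [hf]; unfold stepHol; simp [Pi.mul_apply]
          have hg' : g = V₀ x μ := by rw [hg]; unfold stepHol; simp
          rw [hf', hg', Units.val_mul, mul_assoc, Units.mul_inv, mul_one]
        have htstep : tstep V₀ Y x (μ, true) = Y x μ := by unfold tstep; simp
        have eZ : Z = Y x μ := by rw [hZ, hfg, hY]
        have hstepA : δs = ‖Y x μ‖ := by rw [hδs]; unfold stepA; simp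
        rw [eZ, htstep, sub_self, norm_zero, hstepA]
        exact ⟨le_rfl, by positivity⟩
    obtain ⟨hZδ, hZ1⟩ := hZ0
    -- the recursion `D' = Z + g D g⁻¹ + Z (g D g⁻¹)`
    have hgg : ((g⁻¹ : 𝔸ˣ) : 𝔸) * (g : 𝔸) = 1 := Units.inv_mul g
    have hhol : ((hol (V₁ * V₀) x (l :: w) : 𝔸ˣ) : 𝔸) = (f : 𝔸) * F := by rw [hol_cons, Units.val_mul]
    have hhol₀ : (((hol V₀ x (l :: w))⁻¹ : 𝔸ˣ) : 𝔸) = F₀i * ((g⁻¹ : 𝔸ˣ) : 𝔸) := by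
      rw [hol_cons, mul_inv_rev, Units.val_mul]
    have erec : (f : 𝔸) * F * (F₀i * ((g⁻¹ : 𝔸ˣ) : 𝔸)) - 1
        = Z + (g : 𝔸) * D * ((g⁻¹ : 𝔸ˣ) : 𝔸) + Z * ((g : 𝔸) * D * ((g⁻¹ : 𝔸ˣ) : 𝔸)) := by
      rw [hZ, hD]
      have e1 : ((f : 𝔸) * ((g⁻¹ : 𝔸ˣ) : 𝔸) - 1) * ((g : 𝔸) * (F * F₀i - 1) * ((g⁻¹ : 𝔸ˣ) : 𝔸))
          = (f : 𝔸) * (((g⁻¹ : 𝔸ˣ) : 𝔸) * (g : 𝔸)) * (F * F₀i - 1) * ((g⁻¹ : 𝔸ˣ) : 𝔸) - (g : 𝔸) * (F * F₀i - 1) * ((g⁻¹ : 𝔸ˣ) : 𝔸) := by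
        noncomm_ring
      rw [e1, hgg, mul_one]
      noncomm_ring
    rw [hhol, hhol₀, tsum_cons, erec]
    have hconj : ‖(g : 𝔸) * D * ((g⁻¹ : 𝔸ˣ) : 𝔸)‖ ≤ ‖D‖ := norm_units_conj_le hg1 D
    have hgD : ‖(g : 𝔸) * D * ((g⁻¹ : 𝔸ˣ) : 𝔸)‖ ≤ Pg - 1 := hconj.trans ih₀
    constructor
    · calc ‖Z + (g : 𝔸) * D * ((g⁻¹ : 𝔸ˣ) : 𝔸) + Z * ((g : 𝔸) * D * ((g⁻¹ : 𝔸ˣ) : 𝔸))‖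
          ≤ ‖Z‖ + ‖(g : 𝔸) * D * ((g⁻¹ : 𝔸ˣ) : 𝔸)‖ + ‖Z‖ * ‖(g : 𝔸) * D * ((g⁻¹ : 𝔸ˣ) : 𝔸)‖ :=
            (norm_add_le _ _).trans (add_le_add (norm_add_le _ _) (norm_mul_le _ _))
        _ ≤ δs + (Pg - 1) + δs * (Pg - 1) := add_le_add (add_le_add hZδ hgD) (mul_le_mul hZδ hgD (norm_nonneg _) hδs0)
        _ = (1 + δs) * Pg - 1 := by ring
    · have e : Z + (g : 𝔸) * D * ((g⁻¹ : 𝔸ˣ) : 𝔸) + Z * ((g : 𝔸) * D * ((g⁻¹ : 𝔸ˣ) : 𝔸)) - (tstep V₀ Y x l + conjR g Λ)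
          = (Z - tstep V₀ Y x l) + (g : 𝔸) * (D - Λ) * ((g⁻¹ : 𝔸ˣ) : 𝔸) + Z * ((g : 𝔸) * D * ((g⁻¹ : 𝔸ˣ) : 𝔸)) := by
        rw [conjR_apply]; noncomm_ring
      rw [e]
      calc ‖(Z - tstep V₀ Y x l) + (g : 𝔸) * (D - Λ) * ((g⁻¹ : 𝔸ˣ) : 𝔸) + Z * ((g : 𝔸) * D * ((g⁻¹ : 𝔸ˣ) : 𝔸))‖
          ≤ ‖Z - tstep V₀ Y x l‖ + ‖(g : 𝔸) * (D - Λ) * ((g⁻¹ : 𝔸ˣ) : 𝔸)‖ + ‖Z‖ * ‖(g : 𝔸) * D * ((g⁻¹ : 𝔸ˣ) : 𝔸)‖ :=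
            (norm_add_le _ _).trans (add_le_add (norm_add_le _ _) (norm_mul_le _ _))
        _ ≤ δs ^ 2 + (Pg - 1 - Sg + Sg2) + δs * (Pg - 1) :=
            add_le_add (add_le_add hZ1 ((norm_units_conj_le hg1 _).trans ih₁)) (mul_le_mul hZδ hgD (norm_nonneg _) hδs0)
        _ = (1 + δs) * Pg - 1 - (δs + Sg) + (δs ^ 2 + Sg2) := by ring

/-- ★ **`‖(V₁V₀)(Γ)·V₀(Γ)⁻¹ − 1‖ ≤ 2m` and `‖(V₁V₀)(Γ)·V₀(Γ)⁻¹ − 1 − (R_{0,x}Y)(Γ)‖ ≤ 2m²`** once the walk mass `Σ_sδ_s ≤ m ≤ 1`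
(`Π(1+δ) − 1 ≤ e^{Σδ} − 1`, `e^t − 1 − t ≤ t²` on `[0,1]`, `Σδ² ≤ (Σδ)²`). [cite: Balaban1985Averaging, (122)-(123) p.36] -/
theorem norm_holRatio_le_of_mass_le (V₀ V₁ : Site d → Fin d → 𝔸ˣ) (hV₀ : ∀ x μ, V₀ x μ ∈ U1 𝔸) (hV₁ : ∀ x μ, V₁ x μ ∈ U1 𝔸)
    (Y : Site d → Fin d → 𝔸) (hY : ∀ x μ, Y x μ = ((V₁ x μ : 𝔸ˣ) : 𝔸) - 1) (x : Site d) (w : List (Letter d)) {m : ℝ}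
    (hm : ((List.zip (List.scanl (fun (y : Site d) (l' : Letter d) => y + l'.vec) x w) w).map fun s => ‖stepA Y s.1 s.2‖).sum ≤ m)
    (hm1 : m ≤ 1) :
    ‖((hol (V₁ * V₀) x w : 𝔸ˣ) : 𝔸) * (((hol V₀ x w)⁻¹ : 𝔸ˣ) : 𝔸) - 1‖ ≤ 2 * m ∧
      ‖((hol (V₁ * V₀) x w : 𝔸ˣ) : 𝔸) * (((hol V₀ x w)⁻¹ : 𝔸ˣ) : 𝔸) - 1 - tsum V₀ Y x w‖ ≤ 2 * m ^ 2 := by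
  obtain ⟨h₀, h₁⟩ := norm_holRatio_bounds_perStep V₀ V₁ hV₀ hV₁ Y hY x w
  set γ := List.zip (List.scanl (fun (y : Site d) (l' : Letter d) => y + l'.vec) x w) w with hγ
  set S : ℝ := (γ.map fun s => ‖stepA Y s.1 s.2‖).sum with hS
  have hS0 : 0 ≤ S := List.sum_nonneg fun y hy => by obtain ⟨z, _, rfl⟩ := List.mem_map.mp hy; exact norm_nonneg _
  have hs1 : S ≤ 1 := hm.trans hm1
  have hprod : (γ.map fun s => 1 + ‖stepA Y s.1 s.2‖).prod ≤ Real.exp S :=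
    list_prod_one_add_le_exp_sum (fun s : Site d × Letter d => ‖stepA Y s.1 s.2‖) (fun _ => norm_nonneg _) γ
  have hexp : |Real.exp S - 1 - S| ≤ S ^ 2 := Real.abs_exp_sub_one_sub_id_le (by rw [abs_of_nonneg hS0]; exact hs1)
  have hsq : (γ.map fun s => ‖stepA Y s.1 s.2‖ ^ 2).sum ≤ S ^ 2 :=
    list_sum_sq_le_sq_sum (fun s : Site d × Letter d => ‖stepA Y s.1 s.2‖) (fun _ => norm_nonneg _) γ
  have h3 := list_prod_one_add_sub_one_le_two_mul (fun s : Site d × Letter d => ‖stepA Y s.1 s.2‖) (fun _ => norm_nonneg _) γ hs1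
  have hSm : S ^ 2 ≤ m ^ 2 := pow_le_pow_left₀ hS0 hm 2
  have habs := le_abs_self (Real.exp S - 1 - S)
  exact ⟨h₀.trans (h3.trans (by linarith)), h₁.trans (by nlinarith)⟩

end PerStep


end Summit.QuantumFields.YangMills.Theorems.Prop7CombHolRatioPerStep

end
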